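import Mathlib

/-!
# SoloBlind — the level-44 Koblitz–Ogus class `α₄₄` survives at level 132

Finite certificates behind `paper/hafnian-theorem.md` §11.7 (THEOREM Z⁺⁺, PROPOSITION 2C(ii)) of the solo-blind
programme on the Kontsevich–Zagier conjecture; companion of `SoloBlindLevelRaising44` (`α₄₄` at 44 and 88) and
`SoloBlindLevel52` (`α₅₂` at 52, 104, 156).

A `GammaMonomial` of level `N` is a list of (index, exponent) pairs encoding `∏ Γ(k/N)^{e_k}`.  The
one-dimensional lattice `D_N` is generated by reflections `e_k + e_{N-k}`, Gauss multiplication units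
`Σ_{j<d} e_{k+jN/d} - e_{dk}` (`d ∣ N`, `d > 1`; and `Σ_{0<j<d} e_{jN/d}`) and two-term Beta units `β(t) - β(t')`
for Fermat triples `t, t'` of level `N` with the same CM type.  The level-44 class `α₄₄` is represented by the
Koblitz–Ogus unit `v44 = Γ(3/44)Γ(7/44)Γ(11/44) / (Γ(5/44)Γ(8/44)Γ(9/44)Γ(21/44))` (constant Koblitz–Ogus sums
`-22`); its pull-back to level 132 is `v44at132` (indices tripled).
The separating functional is the parity of the number of factors `Γ(k/N)^{±1}` whose argument has reduced
denominator exactly `11`, i.e. `12 ∣ k` at level 132 (`N ∤ k`).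
* `l132_*`: at level 132 = 2·66 the functional is even on all reflection and multiplication generators and on all
  two-term units (2904 Fermat triples, 2386 CM types: equal CM type ⇒ equal parity, by a radix partition on the
  CM key), and odd on `v44at132`; hence `α₄₄ ∉ D₁₃₂` — although 66 (where the level-33 class dies) divides 132.
132 is the smallest multiple of 44 divisible by the exceptional level 66; under the generation form of Aoki's
classification of CM-type coincidences the certificates at 44, 88 (companion file) and 132 are the finite core of
the immortality of `α₄₄` (the same functional works at every level `M` with `11 ∥ M`, PROPOSITION 2C).
-/

namespace Summit.KontsevichZagierPeriods.KontsevichZagierPeriods.Theorems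
namespace SoloBlind
namespace Level132

/-- A Γ-monomial of level `N` as a list of (index, exponent) pairs; indices are read mod `N`. -/
abbrev GammaMonomial := List (ℕ × ℤ)

/-- Koblitz–Ogus sum `S_u(e) = Σ e_k ⟨u k⟩_N`. -/
def koSumOf (N u : ℕ) (e : GammaMonomial) : ℤ :=
  e.foldl (fun acc kc => acc + kc.2 * (((u * kc.1) % N : ℕ) : ℤ)) 0

/-- The units mod `N` in `1 … N-1`. -/
def unitsMod (N : ℕ) : List ℕ := (List.range N).filter fun u => Nat.gcd u N == 1

/-- `v44 = e₃ - e₅ + e₇ - e₈ - e₉ + e₁₁ - e₂₁` (level 44), the Koblitz–Ogus unit representing `α₄₄`. -/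
def v44 : GammaMonomial := [(3, 1), (5, -1), (7, 1), (8, -1), (9, -1), (11, 1), (21, -1)]

/-- The pull-back of `v44` to level 132: `Γ(k/44) = Γ(3k/132)`. -/
def v44at132 : GammaMonomial := v44.map fun kc => (3 * kc.1, kc.2)

/-- Parity functional: is `Σ_{q ∣ k, N ∤ k} e_k` even?  (`(N,q) = (132,12)`: the number of factors with
argument of reduced denominator exactly `11`.) -/
def wEven (N q : ℕ) (e : GammaMonomial) : Bool :=
  (e.foldl (fun acc kc => if kc.1 % N != 0 && (kc.1 % N) % q == 0 then acc + kc.2 else acc) 0) % 2 == 0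

/-- Reflection generators `e_k + e_{N-k}`, `1 ≤ k ≤ N/2`. -/
def reflGens (N : ℕ) : List GammaMonomial :=
  ((List.range (N / 2)).map fun i => [(i + 1, (1 : ℤ)), (N - (i + 1), 1)])

/-- Gauss multiplication generators `Σ_{j<d} e_{k + jN/d} - e_{dk}` for `d ∣ N`, `d > 1`, `1 ≤ k < N/d`. -/
def multGens (N : ℕ) : List GammaMonomial :=
  (((List.range (N + 1)).filter fun d => 1 < d && N % d == 0).map fun d =>
    (List.range (N / d - 1)).map fun i =>
      let k := i + 1
      ((List.range d).map fun j => (k + j * (N / d), (1 : ℤ))) ++ [(d * k, (-1 : ℤ))]).flatten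

/-- The multiplication relations at `k = 0`: `Σ_{0<j<d} e_{jN/d}` (the value `∏_{0<j<d} Γ(j/d)` is an algebraic
multiple of a power of `π`; included so that the certificate covers the full relation module). -/
def multGensZero (N : ℕ) : List GammaMonomial :=
  ((List.range (N + 1)).filter fun d => 1 < d && N % d == 0).map fun d =>
    ((List.range (d - 1)).map fun j => ((j + 1) * (N / d), (1 : ℤ)))

/-- CM type of the Fermat triple `(a, b, -a-b)` of level `N`, encoded as a bitmask over the units. -/
def cmKey (N a b : ℕ) : ℕ :=
  (unitsMod N).foldl (fun acc u =>
    2 * acc + (if (u * a) % N + (u * b) % N + (u * (N * N - a - b)) % N == N then 1 else 0)) 0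

/-- Fermat triples of level `N` as multisets: `1 ≤ a ≤ b ≤ c ≤ N-1`, `a + b + c ≡ 0 (mod N)`. -/
def fermatTriples (N : ℕ) : List (ℕ × ℕ × ℕ) :=
  (List.range N).flatMap fun a => (List.range N).filterMap fun b =>
    let c := (N * N - a - b) % N
    if 1 ≤ a && a ≤ b && b ≤ c then some (a, b, c) else none

/-- Parity of the number of entries of a triple divisible by `q`. -/
def tripleParity (q : ℕ) (t : ℕ × ℕ × ℕ) : Bool :=
  ((if t.1 % q == 0 then 1 else 0) + (if t.2.1 % q == 0 then 1 else 0)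
    + (if t.2.2 % q == 0 then 1 else 0)) % 2 == 1

/-- Table of (CM type, parity of the number of entries divisible by `q`) over the Fermat triples of level `N`. -/
def cmTable (N q : ℕ) : List (ℕ × Bool) :=
  (fermatTriples N).map fun t => (cmKey N t.1 t.2.1, tripleParity q t)

/-- All-pairs consistency of a table: equal CM type ⇒ equal parity. -/
def pairsOK (tbl : List (ℕ × Bool)) : Bool :=
  tbl.all fun x => tbl.all fun y => x.1 != y.1 || x.2 == y.2

/-- Radix-partitioned consistency check: split the table on bits `b-1, …, 0` of the CM key and check
all-pairs consistency in each part.  Rows with equal keys always land in the same part, so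
`radixOK b tbl = true` is equivalent to `pairsOK tbl = true` (equal CM type ⇒ equal parity). -/
def radixOK : ℕ → List (ℕ × Bool) → Bool
  | 0, tbl => pairsOK tbl
  | b + 1, tbl => radixOK b (tbl.filter fun x => (x.1 >>> b) % 2 == 0)
      && radixOK b (tbl.filter fun x => (x.1 >>> b) % 2 == 1)

/-- The level-132 table (`q = 12`). -/
def cmTable132 : List (ℕ × Bool) := cmTable 132 12

set_option maxRecDepth 8192 in
/-- There are 2904 Fermat triples of level 132 (as multisets). -/
theorem triples_card : (fermatTriples 132).length = 2904 := by
  decide +kernel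

set_option maxRecDepth 8192 in
/-- `v44at132` has constant Koblitz–Ogus sums `-66` at level 132 (all 40 units): a Koblitz–Ogus unit. -/
theorem l132_koUnit : ((unitsMod 132).all fun u => koSumOf 132 u v44at132 == -66) = true := by decide

set_option maxRecDepth 8192 in
/-- Level 132: the functional is even on the 66 reflection generators. -/
theorem l132_refl_even : ((reflGens 132).all (wEven 132 12)) = true := by decide

set_option maxRecDepth 16384 in
/-- Level 132: the functional is even on the multiplication generators (`d = 2, 3, 4, 6, 11, 12, 22, 33, 44, 66, 132`),
including `k = 0`. -/
theorem l132_mult_even : ((multGens 132 ++ multGensZero 132).all (wEven 132 12)) = true := by decide +kernel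

set_option maxRecDepth 8192 in
/-- Level 132: the functional is odd on `v44at132` (exactly one factor, `Γ(24/132)⁻¹ = Γ(2/11)⁻¹`). -/
theorem l132_v_odd : wEven 132 12 v44at132 = false := by decide

set_option maxRecDepth 65536 in
set_option maxHeartbeats 40000000 in
/-- Level 132: Fermat triples with the same CM type have the same parity of the number of entries divisible by
12 (2904 rows, radix partition on 12 key bits); so the functional is even on every two-term unit of level 132 and,
with `l132_refl_even`, `l132_mult_even`, `l132_v_odd`, `v44at132 ∉ D₁₃₂`: the class `α₄₄` survives at 132. -/
theorem l132_twoTerm_even : radixOK 12 cmTable132 = true := by decide +kernel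

end Level132
end SoloBlind
end Summit.KontsevichZagierPeriods.KontsevichZagierPeriods.Theorems
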